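import Summits.FinalStateConjecture.FinalStateConjecture.Theses.TangentConeAtIPlus
import HarnessLib

/-!
# Birth skeleton (BC3) — crux `DecoratedConeExhausts` (stmt-FinalStateConjecture-17671, K4, rank 5),
# route `TangentConeAtIPlus` — line `birth`: "the decoration IS the decomposition"

Skeleton registrar planner-skel-stmt-FinalStateConjecture-17671-0 (planner one-shot, route re-audit bin
REPAIRABLE), 2026-08-17; BC3 of `run/shared/lean/lens3/_common/BC.md`. Target: the route decl
`Summit.FinalStateConjecture.FinalStateConjecture.Theses.TangentConeAtIPlus.DecoratedConeExhausts` BY NAME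
(route file rev 4), concluded by `DecoratedConeExhausts_of` from three named stubs; `lean check --json`
rc 0, sorries 3 = the three `stub_*`, zero elsewhere (the audit block classes `DecoratedConeExhausts_of` as
`proof.conditional` on exactly the three `Sig.*` hypotheses, no `sorryAx`).

K4 reads: for EVERY admissible datum, MGHD `𝒟`, cone data `(N, (Λᵢ,cᵢ), σᵢ, dᵢ, T, U, Φ)` (predicate `Cone`)
and hole data `(Mᵢ, aᵢ, τ₀, Ψᵢ)` (predicate `Holes`) there are `O ⊆ M` and an `N`-hole
`fd : FinalStateDecomposition 𝒟.toSpacetime O 2` with sub-extremal holes, `O = exteriorOf 𝒟 fd.charted`,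
`HasExhaustiveCharts fd` (honest radii) and `IsFutureOriented fd`.

## The line (the route's own two-layer plan `ChartExtension → CausalExhaustion → DecoratedConeExhausts`,
## plus the orientation clause of the re-typed Statement, cut along its three named difficulties)

The crux's why-might-fail names three things: (a) `HasExhaustiveCharts ∀ τ₁` with honest radii and `C²`
convergence down to `r → r₊` force the hole-chart edge to BE `𝓗⁺`; (b) the `x⁰` / `t*ᵢ` slabs do not
join; (c) the orientation of `Ψᵢ` must be propagated from the annulus. The skeleton:

* `stub_chartExtension` (E — CHART EXTENSION WITH CAUSAL EXHAUSTION; ∃-statement, XL; carries (a)+(b)):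
  cone + hole data ⇒ a RAW DECORATION `(τ₁, ρ, R, U', Φ', Ψ')` — a common late time `τ₁`, sublinear
  excision radii `ρᵢ` in flat time, honest certified radii `Rᵢ ≥ max(r₊(Mᵢ,aᵢ),0)+1`, `Rᵢ → ∞`, a flat
  domain `U' ⊇ {x⁰ > τ₁} ∖ ⋃ᵢ {rᵢ(Λᵢ⁻¹(x−cᵢ)) ≤ ρᵢ(x⁰)}` with a flat late chart `Φ'` (`C²`-flat on its
  slabs, `Φ'₊∂₀` eventually future-directed on them), and hole charts `Ψ'ᵢ` of the WHOLE late boosted exteriors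
  `{t*ᵢ > τ₁, rᵢ > r₊}` — all late charts into `O := J⁺(ιΣ) ∩ I⁻(Φ'(late) ∪ ⋃ᵢ Ψ'ᵢ(late))`, with
  `C²` convergence to boosted Kerr on every fixed-radius slab, out to `σᵢ(τ)+4` and out to `Rᵢ(τ)`,
  pairwise separating world-tubes, the global covering clause at `τ₁`, the EXHAUSTION clause for every
  `τ₂ > τ₁` (verbatim `HasExhaustiveCharts`' third conjunct, unfolded), and agreement `Ψ'ᵢ = Φ∘(x ↦
  x + dᵢ(tᵢx))` with the ORIGINAL cone chart `Φ` on the annuli `σᵢ+1 ≤ dist < σᵢ+4` after `τ₁` (the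
  predicate `Spec`, 14 conjuncts, each a field of `FinalStateDecomposition` / `HasExhaustiveCharts` /
  `IsFutureOriented` in raw form, or an input of A below). Informal content: extend the near-region
  embeddings `Ψᵢ` (time-squashed `Φ∘shift` beyond the annulus, squeeze into the early region elsewhere),
  normalise their inner edge to the event horizon (no charted black-hole point, no uncharted late sliver of
  the d.o.c. — both are forced by exhaustion, see "why it might fail"), choose `τ₁` late, `Rᵢ` a monotone
  minorant of `σᵢ+5`, and prove exhaustion by outward null curves in the flat zone and horizon-skimming /
  helical time-lines in the near zones. Why it might fail: exactly (a)+(b) — exhaustion for ALL `τ₂ > τ₁`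
  fails as soon as one charted point lies inside the black hole (it cannot hover at chart radius `> r₊` for
  unbounded chart time) or one d.o.c. point near the hole after `τ₁` is uncharted (it is in the future of the
  `τ₁`-floors), so the edge `{rᵢ = r₊}` of `Ψ'ᵢ` must be exactly `𝓗⁺ ∩ {t*ᵢ > τ₁}` while `C²`
  convergence holds down to it (locate `𝓗⁺`, re-gauge across an uncharted collar, red-shift at `k = 2`:
  DafermosHolzegelRodnianskiTaylor2021 §1, arXiv:0811.0354 §5–7); and the flat floor `{x⁰ = τ₁}` and the
  hole floors `{t*ᵢ = τ₁}` must be joined causally (boost tilt `~ v·σᵢ`). Sources: DafermosLuk2017,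
  DafermosRodnianski2008 = arXiv:0811.0354, DafermosHolzegelRodnianskiTaylor2021, Sbierski2016AHP,
  ONeill1983 Ch. 14. Why E is ONE stub and not `ChartExtension` + `CausalExhaustion`: any ∀-interface
  "every raw decoration satisfying <finite spec> is exhaustive" is refutable by finite-time wildness of the
  charts between `τ₁` and `τ₂` (convergence is only asymptotic) and by edge ≠ horizon; the exhaustion clause
  is a property of THIS construction, so it rides with the ∃ (a lead may re-cut E once the construction is
  written down: the natural children are "horizon-normalised near charts" and "joinable floors").
* `stub_annulusAnchor` (A — ORIENTATION ANCHOR ON THE AGREEMENT ANNULI; ∀-lemma over any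
  `Spacetime 4`, L; carries (c)): for an orthochronous `Λ ∈ O(1,3)`, sub-extremal `(M,a)`, continuous
  sublinear `σ, d` with `σ → ∞`, a smooth flat chart `Φ` on `U` with `C²` deviation from `η` → 0 on the
  slabs `{x⁰ = τ} ∩ U` and `Φ₊∂₀` future-directed on `U`, and a smooth `Ψ` on the boosted Kerr exterior,
  `C²`-close to boosted Kerr out to radius `σ(τ)+4` and equal to `Φ∘(x ↦ x + d(t x))` on the annuli
  `σ(t)+1 ≤ dist < σ(t)+4`, `t > τ₁`: eventually in `τ` some point `x` of the truncated slab
  `{t* = τ, r ≤ σ(τ)+4}` has `Ψ₊(Λ V_{M,a})` future-directed. Content: on the annulus `Ψ = Φ∘shift`, so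
  `Ψ₊(ΛV) = Φ₊(D shift · ΛV)` with `D shift = I + d′(t) ⊗ dt_rest`; BOTH pull-backs being `C⁰`-close to
  `η` there forces `D shift` to be `o(1)`-close to an `η`-isometry of the form `I + λ Λe₀ ⊗ dt_rest`, i.e.
  `λ ∈ {0, −2}` up to `o(1)` (`λ = −2` is the rest-frame TIME REVERSAL); continuity in `t` and sublinearity
  of `d` exclude the `−2` branch, so `D shift → I`, `D shift · ΛV → Λe₀` (since `H = O(M/σ) → 0`), which is
  `η`-timelike with `η(∂₀, Λe₀) = −(Λe₀)⁰ < 0` (orthochronous!), hence in the same `Φ^*g`-timecone as `∂₀`,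
  hence future. Why it might fail: only through a typing slip — e.g. if agreement were demanded on a set of
  times not connected to `+∞` the `−2` branch would survive; as typed (agreement for all rest times `> τ₁`)
  the dichotomy closes. Size L (manifold calculus: local-diffeo inverse of `Φ` from non-degeneracy of
  `Φ^*g`, smoothness of `shift`, quantitative cone comparison). Sources: ONeill1983 Ch. 5 p. 145 and Ch. 9
  pp. 233–236, arXiv:0811.0354 §5.1 (`V = −g♯dt*`, `g(V,V) = −1−2H`).
* `stub_orientationPropagates` (P — ORIENTATION SPREADS OVER THE CONNECTED SLABS; ∀-lemma over any
  `Spacetime 4`, M/L): sub-extremal `(M,a)`, `Ψ` smooth on the boosted Kerr exterior, radii `R(τ) → ∞` with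
  `C²` deviation → 0 on `{t* = τ, r ≤ R(τ)}`, and eventually an anchor point on each such slab where
  `Ψ₊(ΛV)` is future-directed ⇒ for every `ρ`, eventually `Ψ₊(ΛV)` is future-directed on all of
  `{t* = τ, r ≤ ρ}`. Content: `g_{Λ}(ΛV, ΛV) = −1 − 2H ≤ −1` (margin, `H ≥ 0` as `M > 0`), `‖ΛV‖` bounded on
  `r > r₊ ≥ M`, so `C⁰`-smallness makes `Ψ₊(ΛV)` `g`-timelike on the whole slab; the slab
  `{t* = τ, r₊ < r ≤ R}` is connected (an ellipsoidal shell `(r₊, R] × S²` moved by a Poincaré map); the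
  continuous function `g(T∘Ψ, Ψ₊ΛV)` never vanishes on it (reverse Cauchy–Schwarz), so its sign is the
  anchor's. Why it might fail: a critical point of `Ψ` on a late slab would break it — excluded because
  `Ψ^*g` is `ε`-close to the non-degenerate `g_Λ` there; otherwise routine. Sources: ONeill1983 Ch. 5
  (timecones, Lemma 5.26ff), arXiv:0811.0354 §5.1.

`DecoratedConeExhausts_of : Sig.stub_chartExtension → Sig.stub_annulusAnchor → Sig.stub_orientationPropagates →
DecoratedConeExhausts` (the `Sig.*` legend = the stub signatures verbatim, so that the implication has named
binders; E is stated over this file's `Cone` / `Holes` (verbatim the route's `let`-bound predicates, lifted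
to defs) and `Spec`, so that its registered signature is short and `:=`-free; A and P are DEF-FREE and
self-contained via `open … in`). The composition is
the card's thesis "the decoration IS the `FinalStateDecomposition`": it destructures `Cone`/`Holes`, takes E's
raw decoration, BUILDS `fd` field by field (`N`, masses/spins `(Mᵢ,aᵢ)` — `mass_pos`, `abs_spin_le_mass` from
sub-extremality `|aᵢ| < Mᵢ` —, motions = the cone's `(Λᵢ,cᵢ)`, `τ₀ := τ₁`, charts `Ψ'ᵢ`, excision `ρᵢ`, flat
chart `Φ'` on `U'`), gets `O = exteriorOf 𝒟 fd.charted` by `rfl`, `HasExhaustiveCharts fd := ⟨R, …⟩` from E,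
and `IsFutureOriented fd` from the cone's orthochronous `Λᵢ` (clause i), P fed with A's anchor at radius
`σᵢ(τ)+4` (clause ii: A consumes the cone's flat-chart clauses for the ORIGINAL `Φ` and E's annulus
agreement) and E's `Φ'₊∂₀` (clause iii). `decoratedConeExhausts_of_stubs : DecoratedConeExhausts` = the crux
BY NAME modulo the three stubs.

## REGISTRAR'S FLAG (typing of the shared `Cone` predicate; for the tenure planner, not acted on here)

`tubeᵢ(w) := (x ↦ x + dᵢ(tᵢx)) '' {dᵢ ≤ σᵢ(tᵢ·) + w} ∩ {y⁰ > T}` ranges over ALL rest times `tᵢ`, while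
`σᵢ`, `dᵢ` are constrained only at `+∞` (continuity on `ℝ`; `σᵢ → ∞`, `(|σᵢ|+‖dᵢ‖)/s → 0` as `s → +∞`).
A legal `σᵢ(s) = e^{−s} + log(2+|s|)` with a boosted `Λᵢ` (or `dᵢ(s) = −2s·e₀` for `s < 0`) makes
`tubeᵢ(0)` swallow far late regions (the wedge `{rest time ≤ 0, flat time > T}` reaches every late flat slab
at `|x̲| ≳ x⁰/|v|`), so `U ⊇ {y⁰ > T} ∖ ⋃ tubeᵢ(0)` no longer forces `U` to contain the punctured late
half-space: K1 becomes weaker than intended and K4 must produce the flat chart of `fd` (whose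
`setOf_lt_excision_subset_flatDomain` demands the punctured half-space `{x⁰ > τ₀} ∖ {rᵢ ≤ ρᵢ(x⁰)}` with
`ρᵢ = o(t)`) on a region about which no hypothesis speaks. This is why E outputs its own `(U', Φ')` rather
than hard-wiring `flatChart := Φ`, `flatDomain := U` (the kinematic lemma "sublinear flat-time excision radii
absorb the drifted rest-frame tubes", which that wiring needs, is FALSE for such `σᵢ, dᵢ`). Recommended
restatement (route edit, planner's call): intersect the tube with `{x | T < tᵢ x}` (rest time) or require
`σᵢ, dᵢ` constant on `(−∞, 0]`; then E can take `U' := U ∩ {x⁰ > τ₁}`, `Φ' := Φ`.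

Disproof.lean: none exists for this crux at registration (`ledger crux ls stmt-FinalStateConjecture-17671`:
no workfiles), so there is no `_false_without_` obligation to honour. Negatives index (1 entry,
`not_UniformPhotonSphereChannels`): an ODE channel estimate, unrelated to every stub.
BC3 probes (files `bc/alts/*.lean` of the registrar's folder, importing only the route file and the Statement;
`set_option maxHeartbeats 400000`): for each stub `S ∈ {E, A, P}`, `example : S → DecoratedConeExhausts` and
`example : S → FinalStateConjecture` by each of `exact?`, `simpa`, `simpa [DecoratedConeExhausts]`,
`(unfold DecoratedConeExhausts; simpa)`, `aesop` — ALL FAIL (results quoted in the registrar's NOTES.md and on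
the crux item's evidence note).
-/

set_option linter.dupNamespace false

noncomputable section

open scoped Manifold ContDiff Topology
open Filter Set Function TopologicalSpace Literature.Geometry.Lorentzian

namespace Summit.FinalStateConjecture.FinalStateConjecture.Cruxes.DecoratedConeExhausts.Birth

open Summit.FinalStateConjecture.FinalStateConjecture.Theses.TangentConeAtIPlus (DecoratedConeExhausts)

/-! ## The shared predicates

`Cone` and `Holes` are VERBATIM the `let`-bound predicates `Cone` / `Holes` of the route decls
(`Theses.TangentConeAtIPlus.DecoratedConeExhausts`, rev 4), lifted to honest definitions so that the
registered signature of stub E is short and contains no `:=` (the skeleton registrar's scanner cuts a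
signature at its first `:=` and at 3900 characters); they are definitionally equal to the route's
predicates (the composition below feeds the crux's own hypotheses to E unchanged). `Spec` is this
line's RAW DECORATION predicate (see the header). A prover who wants stub E def-free inlines the three
bodies as `let Cone := …; let Holes := …; let Spec := …;` in front of the statement (the registrar's
probe files `bc/alts/stub_chartExtension_*.lean` do exactly that). -/

/-- VERBATIM the route's `let Cone := …` (cone data at `i⁺`: orthochronous motions, continuous
sublinear `σᵢ, dᵢ`, disjoint drifted tubes, `U ⊇` late half-space minus tubes, late flat chart `Φ`
into `J⁺(S)` with `Φ₊∂₀` future, weighted interior flatness, plain `C²` flatness on the slabs, the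
basin clause). -/
def Cone :=
  open Literature.Geometry.Lorentzian in open scoped ContDiff in fun (𝓢 : Spacetime.{0} 4) (S : Set 𝓢.carrier) (N : ℕ) (mo : Fin N → lorentzGroup × E4) (σ : Fin N → ℝ → ℝ) (dr : Fin N → ℝ → E4) (T : ℝ) (U : Opens E4) (Φ : U → 𝓢.carrier) => let t := fun i (x : E4) => poincareInv (mo i).1 (mo i).2 x 0; let d := fun i (x : E4) => E4.spatialNorm (poincareInv (mo i).1 (mo i).2 x); let tube := fun i (w : ℝ) => (fun x ↦ x + dr i (t i x)) '' {x : E4 | d i x ≤ σ i (t i x) + w} ∩ {y | T < y 0}; let F := Minkowski.backgroundOn U; (∀ i, Summit.FinalStateConjecture.IsOrthochronous (mo i).1 ∧ Continuous (σ i) ∧ Continuous (dr i) ∧ Tendsto (fun s : ℝ ↦ (|σ i s| + ‖dr i s‖) / s) atTop (𝓝 0) ∧ Tendsto (σ i) atTop atTop) ∧ (∀ i j, i ≠ j → Disjoint (tube i 5) (tube j 5)) ∧ {y : E4 | T < y 0} \ (⋃ i, tube i 0) ⊆ (U : Set E4) ∧ 𝓢.IsLateChart F (𝓢.metric.causalFuture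 𝓢.timeOrientation S) T Φ ∧ (∀ x : U, 𝓢.timeOrientation.IsFutureDirected (mfderiv 𝓘(ℝ, E4) (𝓡 4) Φ x (EuclideanSpace.single 0 1))) ∧ (∀ δ : ℝ, 0 < δ → Tendsto (fun τ : ℝ ↦ weightedCkSeminorm {x : E4 | x 0 = τ ∧ E4.spatialNorm x ≤ (1 - δ) * τ ∧ ∀ i, δ * τ ≤ d i x} 2 0 (𝓢.deviationExtend F Φ)) atTop (𝓝 0)) ∧ Tendsto (fun τ : ℝ ↦ 𝓢.deviationCk F Φ 2 τ) atTop (𝓝 0) ∧ (∀ i, ∃ M a : ℝ, Kerr.IsSubextremal M a ∧ ∀ ε : ENNReal, 0 < ε → ∀ τ₁ : ℝ, ∃ τ : ℝ, τ₁ ≤ τ ∧ (let B := boostedKerrBackground (mo i).1 (mo i).2 M a; ∃ Ψ : B.domain → 𝓢.carrier, ContMDiff 𝓘(ℝ, E4) (𝓡 4) ∞ Ψ ∧ Topology.IsOpenEmbedding ({x : B.domain | |t i x.1 - τ| < 1 ∧ d i x.1 < σ i (t i x.1) + |a| + 6}.restrict Ψ) ∧ (∀ x : B.domain, |t i x.1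 - τ| < 1 → σ i (t i x.1) + 1 ≤ d i x.1 → d i x.1 < σ i (t i x.1) + 4 → ∃ hx : x.1 + dr i (t i x.1) ∈ (U : Set E4), Ψ x = Φ ⟨_, hx⟩) ∧ 𝓢.truncDeviationCk B Ψ 2 (σ i τ + 5) τ ≤ ε))

/-- VERBATIM the route's `let Holes := …` (hole data: sub-extremal `(Mᵢ,aᵢ)`, `T ≤ τ₀`, smooth `Ψᵢ`
open-embedding the near regions `Wᵢ` into `J⁺(S)`, `C²` convergence on every fixed-radius slab and
out to `σᵢ+5`, annulus agreement with `Φ∘shiftᵢ`, separating truncated world-tubes). -/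
def Holes :=
  open Literature.Geometry.Lorentzian in open scoped ContDiff in fun (𝓢 : Spacetime.{0} 4) (S : Set 𝓢.carrier) (N : ℕ) (mo : Fin N → lorentzGroup × E4) (σ : Fin N → ℝ → ℝ) (dr : Fin N → ℝ → E4) (T : ℝ) (U : Opens E4) (Φ : U → 𝓢.carrier) (M a : Fin N → ℝ) (τ₀ : ℝ) => let B := fun i => boostedKerrBackground (mo i).1 (mo i).2 (M i) (a i); fun (Ψ : ∀ i, (B i).domain → 𝓢.carrier) => let t := fun i (x : E4) => poincareInv (mo i).1 (mo i).2 x 0; let d := fun i (x : E4) => E4.spatialNorm (poincareInv (mo i).1 (mo i).2 x); let W := fun i => {x : (B i).domain | τ₀ < t i x.1 ∧ d i x.1 < σ i (t i x.1) + |a i| + 6}; (∀ i, Kerr.IsSubextremal (M i) (a i)) ∧ T ≤ τ₀ ∧ (∀ i, ContMDiff 𝓘(ℝ, E4) (𝓡 4) ∞ (Ψ i) ∧ Topology.IsOpenEmbedding ((W i).restrict (Ψ i)) ∧ Ψ i '' W i ⊆ 𝓢.metric.causalFuture 𝓢.timeOrientation S) ∧ (∀ i (r : ℝ), Tendsto (fun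 τ : ℝ ↦ 𝓢.truncDeviationCk (B i) (Ψ i) 2 r τ) atTop (𝓝 0)) ∧ (∀ i, Tendsto (fun τ : ℝ ↦ 𝓢.truncDeviationCk (B i) (Ψ i) 2 (σ i τ + 5) τ) atTop (𝓝 0)) ∧ (∀ i (x : (B i).domain), τ₀ < t i x.1 → σ i (t i x.1) + 1 ≤ d i x.1 → d i x.1 < σ i (t i x.1) + 4 → T + 1 < (x.1 + dr i (t i x.1)) 0 → ∃ hx : x.1 + dr i (t i x.1) ∈ (U : Set E4), Ψ i x = Φ ⟨_, hx⟩) ∧ (∀ r : ℝ, ∃ τ₁ : ℝ, Pairwise (Function.onFun Disjoint fun i ↦ Ψ i '' (B i).truncLateRegion τ₁ r))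

/-- This line's RAW DECORATION predicate `Spec 𝓢 S N mo σ dr U Φ M a τ₁ ρ R U' Φ' Ψ'` (14 conjuncts,
each a field of `FinalStateDecomposition` / `HasExhaustiveCharts` / `IsFutureOriented`(iii) in raw form,
or an input of stub A): with `B i := boostedKerrBackground (mo i).1 (mo i).2 (M i) (a i)`,
`F' := Minkowski.backgroundOn U'`, `O := J⁺(S) ∩ I⁻(Φ' '' F'.lateRegion τ₁ ∪ ⋃ i, Ψ' i '' (B i).lateRegion τ₁)`:
(1) every `Ψ' i` is a late chart of `B i` into `O` after `τ₁`; (2) `C²` convergence on every fixed-radius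
slab; (3) … out to `σ i τ + 4`; (4) separating truncated world-tubes; (5) `ρ i t / t → 0`;
(6) `{τ₁ < x⁰ ∧ ∀ i, ρ i x⁰ < rᵢ(Λᵢ⁻¹(x − cᵢ))} ⊆ U'`; (7) `Φ'` is a late chart of `F'` into `O` after
`τ₁`; (8) `deviationCk F' Φ' 2 τ → 0`; (9) the global covering clause at `τ₁`; (10) honest radii
`R i → ∞`, `max (r₊(M i, a i)) 0 + 1 ≤ R i τ`; (11) convergence out to `R i τ`; (12) EXHAUSTION: for
every `τ₂ > τ₁`, `O ∖ certifiedLate(τ₂) ⊆ J⁻(certifiedSlab(τ₂))` (unfolded); (13) eventually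
`Φ'₊∂₀` future-directed on the flat slabs; (14) `Ψ' i = Φ ∘ (x ↦ x + dr i (t i x))` on the annuli
`σ i + 1 ≤ d i < σ i + 4` after `τ₁` (w.r.t. the ORIGINAL cone chart `Φ` on `U`). -/
def Spec :=
  open Literature.Geometry.Lorentzian in open scoped ContDiff in fun (𝓢 : Spacetime.{0} 4) (S : Set 𝓢.carrier) (N : ℕ) (mo : Fin N → lorentzGroup × E4) (σ : Fin N → ℝ → ℝ) (dr : Fin N → ℝ → E4) (U : Opens E4) (Φ : U → 𝓢.carrier) (M a : Fin N → ℝ) (τ₁ : ℝ) (ρ R : Fin N → ℝ → ℝ) (U' : Opens E4) (Φ' : U' → 𝓢.carrier) => let B := fun i => boostedKerrBackground (mo i).1 (mo i).2 (M i) (a i); fun (Ψ' : ∀ i, (B i).domain → 𝓢.carrier) => let t := fun i (x : E4) => poincareInv (mo i).1 (mo i).2 x 0; let d := fun i (x : E4) => E4.spatialNorm (poincareInv (mo i).1 (mo i).2 x); let F' := Minkowski.backgroundOn U'; let O : Set 𝓢.carrier := 𝓢.metric.causalFuture 𝓢.timeOrientation S ∩ 𝓢.metric.chronologicalPast 𝓢.timeOrientation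 (Φ' '' F'.lateRegion τ₁ ∪ ⋃ i, Ψ' i '' (B i).lateRegion τ₁); (∀ i, 𝓢.IsLateChart (B i) O τ₁ (Ψ' i)) ∧ (∀ i (r : ℝ), Tendsto (fun τ : ℝ ↦ 𝓢.truncDeviationCk (B i) (Ψ' i) 2 r τ) atTop (𝓝 0)) ∧ (∀ i, Tendsto (fun τ : ℝ ↦ 𝓢.truncDeviationCk (B i) (Ψ' i) 2 (σ i τ + 4) τ) atTop (𝓝 0)) ∧ (∀ r : ℝ, ∃ τ₂ : ℝ, Pairwise (Function.onFun Disjoint fun i ↦ Ψ' i '' (B i).truncLateRegion τ₂ r)) ∧ (∀ i, Tendsto (fun s : ℝ ↦ ρ i s / s) atTop (𝓝 0)) ∧ ({x : E4 | τ₁ < x 0 ∧ ∀ i, ρ i (x 0) < Kerr.radius (a i) (poincareInv (mo i).1 (mo i).2 x)} ⊆ (U' : Set E4)) ∧ 𝓢.IsLateChart F' O τ₁ Φ' ∧ Tendsto (fun τ : ℝ ↦ 𝓢.deviationCk F' Φ' 2 τ) atTop (𝓝 0) ∧ (O \ ((⋃ i, Ψ' i '' (B i).lateRegion τ₁) ∪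 Φ' '' F'.lateRegion τ₁) ⊆ 𝓢.metric.causalPast 𝓢.timeOrientation ((⋃ i, Ψ' i '' (B i).timeSlab τ₁) ∪ Φ' '' F'.timeSlab τ₁)) ∧ (∀ i, Tendsto (R i) atTop atTop ∧ ∀ τ, max (Kerr.rPlus (M i) (a i)) 0 + 1 ≤ R i τ) ∧ (∀ i, Tendsto (fun τ : ℝ ↦ 𝓢.truncDeviationCk (B i) (Ψ' i) 2 (R i τ) τ) atTop (𝓝 0)) ∧ (∀ τ₂ : ℝ, τ₁ < τ₂ → O \ (Φ' '' F'.lateRegion τ₂ ∪ ⋃ i, Ψ' i '' {x | τ₂ < (B i).time x.1 ∧ (B i).radius x.1 ≤ R i ((B i).time x.1)}) ⊆ 𝓢.metric.causalPast 𝓢.timeOrientation (Φ' '' F'.timeSlab τ₂ ∪ ⋃ i, Ψ' i '' (B i).truncTimeSlab (R i τ₂) τ₂)) ∧ (∀ᶠ τ in atTop, ∀ x ∈ F'.timeSlab τ, 𝓢.timeOrientation.IsFutureDirected (mfderiv 𝓘(ℝ, E4) (𝓡 4) Φ' x (E4.basisVector 0))) ∧ (∀ i (x : (B i).domain), τ₁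 < t i x.1 → σ i (t i x.1) + 1 ≤ d i x.1 → d i x.1 < σ i (t i x.1) + 4 → ∃ hx : x.1 + dr i (t i x.1) ∈ (U : Set E4), Ψ' i x = Φ ⟨_, hx⟩)

/-! ## Legend: the three stub statements as named propositions (verbatim the registered signatures) -/

/-- Statement of `stub_chartExtension` (E): cone + hole data ⇒ a raw decoration `(τ₁, ρ, R, U', Φ', Ψ')`
satisfying `Spec` (late charts into `O = J⁺(ιΣ) ∩ I⁻(charted)`, convergence, separation, excision,
covering at `τ₁`, honest radii, EXHAUSTION for every `τ₂ > τ₁`, flat orientation source, annulus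
agreement with the cone chart `Φ`). -/
def Sig.stub_chartExtension : Prop :=
  open Literature.Geometry.Lorentzian in open scoped ContDiff in ∀ (X : Type) [TopologicalSpace X] [ChartedSpace E3 X] [IsManifold (𝓡 3) ∞ X] [T2Space X] [SecondCountableTopology X] [ConnectedSpace X] (D : InitialDataSet (𝓡 3) X), D ∈ admissibleVacuumData X → ∀ 𝒟 : VacuumCauchyDevelopment D, 𝒟.IsMaximal → ∀ (N : ℕ) (mo : Fin N → lorentzGroup × E4) (σ : Fin N → ℝ → ℝ) (dr : Fin N → ℝ → E4) (T : ℝ) (U : Opens E4) (Φ : U → 𝒟.carrier), Cone 𝒟.toSpacetime (range 𝒟.embed) N mo σ dr T U Φ → ∀ (M a : Fin N → ℝ) (τ₀ : ℝ) (Ψ : ∀ i, (boostedKerrBackground (mo i).1 (mo i).2 (M i) (a i)).domain → 𝒟.carrier), Holes 𝒟.toSpacetime (range 𝒟.embed) N mo σ dr T U Φ M a τ₀ Ψ → ∃ (τ₁ : ℝ) (ρ R : Fin N → ℝ → ℝ) (U' : Opens E4) (Φ' : U' → 𝒟.carrier) (Ψ' : ∀ i, (boostedKerrBackground (mo i).1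 (mo i).2 (M i) (a i)).domain → 𝒟.carrier), Spec 𝒟.toSpacetime (range 𝒟.embed) N mo σ dr U Φ M a τ₁ ρ R U' Φ' Ψ'

/-- Statement of `stub_annulusAnchor` (A): the orientation anchor on the agreement annuli. -/
def Sig.stub_annulusAnchor : Prop :=
  open Literature.Geometry.Lorentzian in open scoped ContDiff in ∀ (𝓢 : Spacetime.{0} 4) (Λ : lorentzGroup) (c : E4) (M a : ℝ) (σ : ℝ → ℝ) (dr : ℝ → E4) (τ₁ : ℝ) (U : Opens E4) (Φ : U → 𝓢.carrier) (Ψ : (boostedKerrBackground Λ c M a).domain → 𝓢.carrier), Summit.FinalStateConjecture.IsOrthochronous Λ → Kerr.IsSubextremal M a → Continuous σ → Continuous dr → Tendsto (fun s : ℝ ↦ (|σ s| + ‖dr s‖) / s) atTop (𝓝 0) → Tendsto σ atTop atTop → ContMDiff 𝓘(ℝ, E4) (𝓡 4) ∞ Φ → Tendsto (fun τ : ℝ ↦ 𝓢.deviationCk (Minkowski.backgroundOn U) Φ 2 τ) atTop (𝓝 0) → (∀ x : U, 𝓢.timeOrientation.IsFutureDirected (mfderiv 𝓘(ℝ, E4)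 (𝓡 4) Φ x (EuclideanSpace.single 0 1))) → ContMDiff 𝓘(ℝ, E4) (𝓡 4) ∞ Ψ → Tendsto (fun τ : ℝ ↦ 𝓢.truncDeviationCk (boostedKerrBackground Λ c M a) Ψ 2 (σ τ + 4) τ) atTop (𝓝 0) → (∀ x : (boostedKerrBackground Λ c M a).domain, τ₁ < poincareInv Λ c x.1 0 → σ (poincareInv Λ c x.1 0) + 1 ≤ E4.spatialNorm (poincareInv Λ c x.1) → E4.spatialNorm (poincareInv Λ c x.1) < σ (poincareInv Λ c x.1 0) + 4 → ∃ hx : x.1 + dr (poincareInv Λ c x.1 0) ∈ (U : Set E4), Ψ x = Φ ⟨_, hx⟩) → ∀ᶠ τ in atTop, ∃ x ∈ (boostedKerrBackground Λ c M a).truncTimeSlab (σ τ + 4) τ, 𝓢.timeOrientation.IsFutureDirected (mfderiv 𝓘(ℝ, E4) (𝓡 4) Ψ x ((Λ : E4 ≃L[ℝ] E4) (Kerr.timeVector M a (poincareInv Λ c (x : E4)))))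

/-- Statement of `stub_orientationPropagates` (P): future orientation spreads over the connected
truncated slabs. -/
def Sig.stub_orientationPropagates : Prop :=
  open Literature.Geometry.Lorentzian in open scoped ContDiff in ∀ (𝓢 : Spacetime.{0} 4) (Λ : lorentzGroup) (c : E4) (M a : ℝ) (R : ℝ → ℝ) (Ψ : (boostedKerrBackground Λ c M a).domain → 𝓢.carrier), Kerr.IsSubextremal M a → ContMDiff 𝓘(ℝ, E4) (𝓡 4) ∞ Ψ → Tendsto R atTop atTop → Tendsto (fun τ : ℝ ↦ 𝓢.truncDeviationCk (boostedKerrBackground Λ c M a) Ψ 2 (R τ) τ) atTop (𝓝 0) → (∀ᶠ τ in atTop, ∃ x ∈ (boostedKerrBackground Λ c M a).truncTimeSlab (R τ) τ, 𝓢.timeOrientation.IsFutureDirected (mfderiv 𝓘(ℝ, E4) (𝓡 4) Ψ x ((Λ : E4 ≃L[ℝ] E4) (Kerr.timeVector M a (poincareInv Λ c (x : E4)))))) → ∀ ρ : ℝ, ∀ᶠ τ in atTop, ∀ x ∈ (boostedKerrBackground Λ c M a).truncTimeSlab ρ τ, 𝓢.timeOrientation.IsFutureDirected (mfderiv 𝓘(ℝ,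 E4) (𝓡 4) Ψ x ((Λ : E4 ≃L[ℝ] E4) (Kerr.timeVector M a (poincareInv Λ c (x : E4)))))

/-! ## Registered stubs (`sorry` only here; E over `Cone`/`Holes`/`Spec` above, A and P def-free and self-contained) -/

/-- **E — CHART EXTENSION WITH CAUSAL EXHAUSTION** (the route's `ChartExtension → CausalExhaustion`, fused; XL).
For every admissible datum, MGHD `𝒟`, cone data and hole data: a raw decoration `(τ₁, ρ, R, U', Φ', Ψ')` with
`Spec` — hole charts `Ψ'ᵢ` of the whole late boosted exteriors and a flat chart `Φ'` on
`U' ⊇ {x⁰ > τ₁} ∖ ⋃ᵢ {rᵢ ≤ ρᵢ(x⁰)}`, all late charts into `O = J⁺(ιΣ) ∩ I⁻(charted)`, `C²` convergence (every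
fixed radius, out to `σᵢ+4`, out to the honest radii `Rᵢ ≥ max(r₊,0)+1`, `Rᵢ → ∞`; flat slabs), separation,
sublinear `ρᵢ`, covering at `τ₁`, EXHAUSTION for every `τ₂ > τ₁`, `Φ'₊∂₀` eventually future-directed on the flat slabs, and
`Ψ'ᵢ = Φ∘shiftᵢ` on the annuli `σᵢ+1 ≤ dist < σᵢ+4` after `τ₁`. Why it might fail: exhaustion ∀ `τ₂` forces the
edge `{rᵢ = r₊}` of `Ψ'ᵢ` to be exactly `𝓗⁺` with `C²` convergence down to it (locate / re-gauge / red-shift at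
`k = 2`), and the flat and Kerr-star floors must be joined causally; plus the REGISTRAR'S FLAG (perverse tubes
⇒ `Φ'` may have to be built beyond `U`). Sources: DafermosLuk2017, arXiv:0811.0354 §5–7,
DafermosHolzegelRodnianskiTaylor2021 §1, Sbierski2016AHP, ONeill1983 Ch. 14. -/
theorem stub_chartExtension : open Literature.Geometry.Lorentzian in open scoped ContDiff in ∀ (X : Type) [TopologicalSpace X] [ChartedSpace E3 X] [IsManifold (𝓡 3) ∞ X] [T2Space X] [SecondCountableTopology X] [ConnectedSpace X] (D : InitialDataSet (𝓡 3) X), D ∈ admissibleVacuumData X → ∀ 𝒟 : VacuumCauchyDevelopment D, 𝒟.IsMaximal → ∀ (N : ℕ) (mo : Fin N → lorentzGroup × E4) (σ : Fin N → ℝ → ℝ) (dr : Fin N → ℝ → E4) (T : ℝ) (U : Opens E4) (Φ : U → 𝒟.carrier), Cone 𝒟.toSpacetime (range 𝒟.embed) N mo σ dr T U Φ → ∀ (M a : Fin N → ℝ) (τ₀ : ℝ) (Ψ : ∀ i, (boostedKerrBackground (mo i).1 (mo i).2 (M i) (a i)).domain → 𝒟.carrier), Holes 𝒟.toSpacetime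 (range 𝒟.embed) N mo σ dr T U Φ M a τ₀ Ψ → ∃ (τ₁ : ℝ) (ρ R : Fin N → ℝ → ℝ) (U' : Opens E4) (Φ' : U' → 𝒟.carrier) (Ψ' : ∀ i, (boostedKerrBackground (mo i).1 (mo i).2 (M i) (a i)).domain → 𝒟.carrier), Spec 𝒟.toSpacetime (range 𝒟.embed) N mo σ dr U Φ M a τ₁ ρ R U' Φ' Ψ' := by
  sorry

/-- **A — ORIENTATION ANCHOR ON THE AGREEMENT ANNULI** (∀-lemma over any `Spacetime 4`; L). Orthochronous
`Λ`, sub-extremal `(M,a)`, continuous sublinear `σ, d` with `σ → ∞`; a smooth flat chart `Φ` on `U`, `C²`-flat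
on its slabs in the limit, `Φ₊∂₀` future-directed on `U`; a smooth `Ψ` on the boosted Kerr exterior, `C²`-close
to boosted Kerr out to `σ(τ)+4`, equal to `Φ∘(x ↦ x + d(t x))` on the annuli after `τ₁` ⇒ eventually every
slab `{t* = τ, r ≤ σ(τ)+4}` carries a point where `Ψ₊(ΛV_{M,a})` is future-directed. Content: both pull-backs
`C⁰`-close to `η` on the annulus force `D shift = I + d′(t) ⊗ dt_rest` to be `o(1)`-close to `I` or to the
rest-frame time reversal `I − 2 Λe₀ ⊗ dt_rest`; continuity in `t` plus sublinearity of `d` kill the second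
branch; then `D shift · ΛV → Λe₀`, `η`-timelike with `η(∂₀, Λe₀) < 0` (orthochronous), so `Φ₊` of it is
future with `Φ₊∂₀`. Why it might fail: only if agreement held merely on a set of times not connected to `+∞`
(then the time-reversed branch survives) — excluded as typed. Sources: ONeill1983 Ch. 5 p. 145, Ch. 9
pp. 233–236; arXiv:0811.0354 §5.1. -/
theorem stub_annulusAnchor : open Literature.Geometry.Lorentzian in open scoped ContDiff in ∀ (𝓢 : Spacetime.{0} 4) (Λ : lorentzGroup) (c : E4) (M a : ℝ) (σ : ℝ → ℝ) (dr : ℝ → E4) (τ₁ : ℝ) (U : Opens E4) (Φ : U → 𝓢.carrier) (Ψ : (boostedKerrBackground Λ c M a).domain → 𝓢.carrier), Summit.FinalStateConjecture.IsOrthochronous Λ → Kerr.IsSubextremal M a → Continuous σ → Continuous dr → Tendsto (fun s : ℝ ↦ (|σ s| + ‖dr s‖) / s) atTop (𝓝 0) → Tendsto σ atTop atTop → ContMDiff 𝓘(ℝ, E4) (𝓡 4) ∞ Φ → Tendsto (fun τ : ℝ ↦ 𝓢.deviationCk (Minkowski.backgroundOn U) Φ 2 τ) atTop (𝓝 0)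 → (∀ x : U, 𝓢.timeOrientation.IsFutureDirected (mfderiv 𝓘(ℝ, E4) (𝓡 4) Φ x (EuclideanSpace.single 0 1))) → ContMDiff 𝓘(ℝ, E4) (𝓡 4) ∞ Ψ → Tendsto (fun τ : ℝ ↦ 𝓢.truncDeviationCk (boostedKerrBackground Λ c M a) Ψ 2 (σ τ + 4) τ) atTop (𝓝 0) → (∀ x : (boostedKerrBackground Λ c M a).domain, τ₁ < poincareInv Λ c x.1 0 → σ (poincareInv Λ c x.1 0) + 1 ≤ E4.spatialNorm (poincareInv Λ c x.1) → E4.spatialNorm (poincareInv Λ c x.1) < σ (poincareInv Λ c x.1 0) + 4 → ∃ hx : x.1 + dr (poincareInv Λ c x.1 0) ∈ (U : Set E4), Ψ x = Φ ⟨_, hx⟩) → ∀ᶠ τ in atTop, ∃ x ∈ (boostedKerrBackground Λ c M a).truncTimeSlab (σ τ + 4) τ, 𝓢.timeOrientation.IsFutureDirected (mfderiv 𝓘(ℝ, E4) (𝓡 4) Ψ x ((Λ : E4 ≃L[ℝ] E4) (Kerr.timeVector M a (poincareInv Λ c (x : E4))))) := by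
  sorry

/-- **P — FUTURE ORIENTATION SPREADS OVER THE CONNECTED TRUNCATED SLABS** (∀-lemma over any `Spacetime 4`;
M/L). Sub-extremal `(M,a)`, `Ψ` smooth on the boosted Kerr exterior, `R(τ) → ∞` with `C²` deviation → 0 on
`{t* = τ, r ≤ R(τ)}`, and eventually an anchor on each such slab where `Ψ₊(ΛV_{M,a})` is future-directed ⇒
for every `ρ`, eventually `Ψ₊(ΛV)` is future-directed on all of `{t* = τ, r ≤ ρ}`. Content: `g_Λ(ΛV,ΛV) =
−1 − 2H ≤ −1` and `‖ΛV‖` bounded on `r > r₊ ≥ M`, so `C⁰`-smallness makes `Ψ₊(ΛV)` timelike on the slab; the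
slab `{t* = τ, r₊ < r ≤ R}` is connected (a moved ellipsoidal shell `(r₊, R] × S²`); `g(T∘Ψ, Ψ₊ΛV)` is
continuous and never `0` there (reverse Cauchy–Schwarz), so its sign is the anchor's. Why it might fail: a
critical point of `Ψ` on a late slab — excluded by `ε`-closeness to the non-degenerate `g_Λ`; otherwise
routine topology. Sources: ONeill1983 Ch. 5 (Lemma 5.26ff), arXiv:0811.0354 §5.1. -/
theorem stub_orientationPropagates : open Literature.Geometry.Lorentzian in open scoped ContDiff in ∀ (𝓢 : Spacetime.{0} 4) (Λ : lorentzGroup) (c : E4) (M a : ℝ) (R : ℝ → ℝ) (Ψ : (boostedKerrBackground Λ c M a).domain → 𝓢.carrier), Kerr.IsSubextremal M a → ContMDiff 𝓘(ℝ, E4) (𝓡 4) ∞ Ψ → Tendsto R atTop atTop → Tendsto (fun τ : ℝ ↦ 𝓢.truncDeviationCk (boostedKerrBackground Λ c M a) Ψ 2 (R τ) τ) atTop (𝓝 0) → (∀ᶠ τ in atTop, ∃ x ∈ (boostedKerrBackground Λ c M a).truncTimeSlab (R τ) τ, 𝓢.timeOrientation.IsFutureDirected (mfderiv 𝓘(ℝ,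 E4) (𝓡 4) Ψ x ((Λ : E4 ≃L[ℝ] E4) (Kerr.timeVector M a (poincareInv Λ c (x : E4)))))) → ∀ ρ : ℝ, ∀ᶠ τ in atTop, ∀ x ∈ (boostedKerrBackground Λ c M a).truncTimeSlab ρ τ, 𝓢.timeOrientation.IsFutureDirected (mfderiv 𝓘(ℝ, E4) (𝓡 4) Ψ x ((Λ : E4 ≃L[ℝ] E4) (Kerr.timeVector M a (poincareInv Λ c (x : E4))))) := by
  sorry

/-! ## Composition: the crux BY NAME from the three stubs (real proof, no `sorry`) -/

/-- **K4 from E, A, P — "the decoration IS the `FinalStateDecomposition`".** Destructure the cone and hole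
predicates; take E's raw decoration `(τ₁, ρ, R, U', Φ', Ψ')`; build `fd` field by field (`N` holes `(Mᵢ, aᵢ)`
— `0 < Mᵢ`, `|aᵢ| ≤ Mᵢ` from sub-extremality —, motions the cone's `(Λᵢ, cᵢ)`, `τ₀ := τ₁`, hole charts `Ψ'ᵢ`,
excision `ρᵢ`, flat chart `Φ'` on `U'`); `O = exteriorOf 𝒟 fd.charted` holds by `rfl`; `HasExhaustiveCharts fd`
is `⟨R, honest radii, convergence out to R, exhaustion⟩` from E; `IsFutureOriented fd` is (i) the cone's
orthochronous `Λᵢ`, (ii) P at radii `σᵢ(τ)+4` fed with A's anchor (A consumes the cone's clauses on the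
ORIGINAL flat chart `Φ` and E's annulus agreement), (iii) E's `Φ'₊∂₀`. -/
theorem DecoratedConeExhausts_of :
    Sig.stub_chartExtension → Sig.stub_annulusAnchor → Sig.stub_orientationPropagates →
      DecoratedConeExhausts := by
  intro hE hA hP X _ _ _ _ _ _ D hD 𝒟 h𝒟 N mo σ dr T U Φ hcone M a τ₀ Ψ hholes
  -- E: the raw decoration.
  obtain ⟨τ₁, ρ, R, U', Φ', Ψ', hspec⟩ := hE X D hD 𝒟 h𝒟 N mo σ dr T U Φ hcone M a τ₀ Ψ hholes
  obtain ⟨hlate, hconv, hconv5, hsep, hρ, hU', hflat, hflatconv, hcov, hR, hconvR, hexh, hfo', hagree⟩ :=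
    hspec
  -- the clauses of the cone and hole predicates that the assembly consumes
  obtain ⟨hkin, -, -, hΦlate, hΦfut, -, hΦconv, -⟩ := hcone
  have hsub : ∀ i, Kerr.IsSubextremal (M i) (a i) := hholes.1
  -- the decomposed region: `J⁺(ιΣ) ∩ I⁻(charted late region after τ₁)` (verbatim `Spec`'s `O`)
  set O : Set 𝒟.carrier := 𝒟.toSpacetime.metric.causalFuture 𝒟.toSpacetime.timeOrientation
      (range 𝒟.embed) ∩ 𝒟.toSpacetime.metric.chronologicalPast 𝒟.toSpacetime.timeOrientation
      (Φ' '' (Minkowski.backgroundOn U').lateRegion τ₁ ∪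
        ⋃ i, Ψ' i '' (boostedKerrBackground (mo i).1 (mo i).2 (M i) (a i)).lateRegion τ₁) with hO
  -- THE DECORATION IS THE DECOMPOSITION: `N` holes `(Mᵢ, aᵢ)` with the cone's motions `(Λᵢ, cᵢ)`,
  -- hole charts `Ψ'ᵢ`, common late time `τ₁`, excision radii `ρᵢ`, flat chart `Φ'` on `U'`.
  let fd : FinalStateDecomposition 𝒟.toSpacetime O 2 :=
    { N := N
      mass := M
      spin := a
      mass_pos := fun i ↦ (abs_nonneg (a i)).trans_lt (hsub i)
      abs_spin_le_mass := fun i ↦ (hsub i).le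
      motion := mo
      τ₀ := τ₁
      chart := Ψ'
      isLateChart := hlate
      tendsto_truncDeviationCk := hconv
      exists_pairwise_disjoint := hsep
      excision := ρ
      tendsto_excision_div := hρ
      flatDomain := U'
      setOf_lt_excision_subset_flatDomain := hU'
      flatChart := Φ'
      isLateChart_flat := hflat
      tendsto_deviationCk_flat := hflatconv
      diff_subset_causalPast := hcov }
  refine ⟨O, fd, hsub, rfl, ⟨R, hR, hconvR, hexh⟩, fun i ↦ (hkin i).1, fun i ρ' ↦ ?_, ?_⟩
  · -- (ii) hole-chart orientation: anchor on the agreement annuli (A), then propagate over the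
    -- connected truncated slabs out to `σᵢ(τ) + 4` (P).
    obtain ⟨hortho, hσc, hdrc, hsubl, hσtop⟩ := hkin i
    exact hP 𝒟.toSpacetime (mo i).1 (mo i).2 (M i) (a i) (fun τ ↦ σ i τ + 4) (Ψ' i) (hsub i)
      (hlate i).contMDiff (tendsto_atTop_add_const_right _ _ hσtop) (hconv5 i)
      (hA 𝒟.toSpacetime (mo i).1 (mo i).2 (M i) (a i) (σ i) (dr i) τ₁ U Φ (Ψ' i) hortho (hsub i)
        hσc hdrc hsubl hσtop hΦlate.contMDiff hΦconv hΦfut (hlate i).contMDiff (hconv5 i)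
        (hagree i)) ρ'
  · -- (iii) flat-chart orientation: `Φ'₊ ∂₀` is eventually future-directed on the flat slabs (E).
    exact hfo'

/-- The crux BY NAME, closed modulo the three registered stubs (its only axiom beyond the standard ones is
the stubs' `sorryAx`). -/
theorem decoratedConeExhausts_of_stubs : DecoratedConeExhausts :=
  DecoratedConeExhausts_of stub_chartExtension stub_annulusAnchor stub_orientationPropagates

end Summit.FinalStateConjecture.FinalStateConjecture.Cruxes.DecoratedConeExhausts.Birth

end
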